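import Summits.ValiantsHypothesis.ValiantsHypothesis.Theses.AnyonJets
import Summits.ValiantsHypothesis.ValiantsHypothesis.Theorems.AnyonJetsUniformJetUpperBoundStubPencilVNP
import Summits.ValiantsHypothesis.ValiantsHypothesis.Theorems.AnyonJetsUniformJetUpperBoundStubJetTaylor
import Summits.ValiantsHypothesis.ValiantsHypothesis.Theorems.FermionicJetPencilControlsHC
import Literature.Computability.AlgebraicComplexity.IMMInVPProofs
import Literature.Computability.AlgebraicComplexity.ArithCircuitProofs
import Literature.Computability.AlgebraicComplexity.ValiantClasses

/-!
# Route `AnyonJets`, crux `UniformJetUpperBound` (stmt-ValiantsHypothesis-16739) — SETTLED (proved)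

**Item.** If `VP_ℂ = VNP_ℂ` then there are `c, n₀` with `L_ℂ(J_{n,k}) ≤ n^c` for all `n ≥ n₀` and
ALL orders `k`, where `J_{n,k} = ∑_σ sgn σ · binom(inv σ, k) · ∏ᵢ X_{σ i, i}` are the inversion
("anyonic") jets of the route (`Theses.AnyonJets.UniformJetUpperBound`, crux, rank 4; "theorem on
paper, filed as crux because `closes` consumes it").

**Proof** (the registered line `birth`, `Cruxes/UniformJetUpperBound/Lines/birth.lean`, whose
composition is reproduced here over the two landed stubs):

* `stub_pencilVNP` (`AnyonJetsUniformJetUpperBoundStubPencilVNP.lean`): the inversion pencil with a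
  VARIABLE coupling, `P_n(q; X) = ∑_σ q^{inv σ} ∏ᵢ X_{σ i, i}` (`n² + 1` variables), is a `VNP` family
  over `ℂ` — Valiant's criterion written out (BCS recogniser × inversion gadget);
* `VP_ℂ = VNP_ℂ` and the bundling lemmas `mem_VNP_ofFintype_iff_holds` / `mem_VP_ofFintype_iff_holds`
  (Bürgisser 2000, Rem. 2.2) put `(P_n)` in `VP`: `L(P_n) ≤ n^a + a`;
* the shift to the fermion point `q ↦ u - 1` costs one gate (`complexity_aeval_le`,
  `complexity_shift_le`);
* `stub_jetTaylor` (`AnyonJetsUniformJetUpperBoundStubJetTaylor.lean`): `F_n = P_n(u-1; X)` has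
  `u`-degree `≤ n(n-1)/2` and `J_{n,k} ⊗ ℂ = (-1)^k [u^k] F_n`;
* the landed interpolation lemma `complexity_coeff_optionEquivLeft_le`
  (`FermionicJetPencilControlsHC.lean`; Strassen 1973 / Bürgisser 2000 §2.1: a `u`-coefficient of a
  polynomial of `u`-degree `≤ d` costs `≤ (d+1)(L+1) + (d+1)`) and one scalar gate give
  `L(J_{n,k}) ≤ (n(n-1)/2 + 1)(n^a + a + 3) + 1 ≤ n^{a+5}` for `n ≥ a + 3`, uniformly in `k`
  (`growth_bound`).

HONEST FRAMING: a conditional upper bound (hypothesis `VP = VNP`) for one explicit family, closing a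
crux of the dormant route AnyonJets whose target `JetExponentUnbounded` remains OPEN; nothing here is
progress on `VP ≠ VNP`, which is NOT proved. No `sorry`, no named-fact hypotheses, no definitions.

References: L. G. Valiant, *Completeness classes in algebra*, STOC 1979; V. Strassen, *Vermeidung
von Divisionen*, Crelle 264 (1973); P. Bürgisser, *Completeness and Reduction in Algebraic
Complexity Theory*, Springer 2000, §2.1, Rem. 2.2, Def. 2.5, Prop. 2.20.
-/

noncomputable section

-- single-conjunct layout: Sub = Summit, duplicated namespace component intended
set_option linter.dupNamespace false

namespace Summit.ValiantsHypothesis.ValiantsHypothesis.Theorems.AnyonJets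

namespace UniformJet

open MvPolynomial Literature.Computability.AlgebraicComplexity
open Summit.ValiantsHypothesis.ValiantsHypothesis.Theorems.FermionicJetPencilControlsHC

/-- **The shift to the fermion point costs one gate**: `F_n = P_n(q ↦ u - 1)` is a substitution
(`complexity_aeval_le`, Bürgisser 2000 Rem. 2.7) in which only `X none ↦ X none - 1` costs a gate.
[cite: Burgisser2000, Rem. 2.7] -/
theorem complexity_shift_le (n : ℕ) :
    complexity (∑ σ : Equiv.Perm (Fin n),
        ((MvPolynomial.X none : MvPolynomial (Option (Fin n × Fin n)) ℂ) - 1) ^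
            (Finset.univ.filter (fun p : Fin n × Fin n => p.1 < p.2 ∧ σ p.2 < σ p.1)).card *
          ∏ i : Fin n, MvPolynomial.X (some (σ i, i))) ≤
      complexity (∑ σ : Equiv.Perm (Fin n),
        (MvPolynomial.X none : MvPolynomial (Option (Fin n × Fin n)) ℂ) ^
            (Finset.univ.filter (fun p : Fin n × Fin n => p.1 < p.2 ∧ σ p.2 < σ p.1)).card *
          ∏ i : Fin n, MvPolynomial.X (some (σ i, i))) + 1 := by
  set g : Option (Fin n × Fin n) → MvPolynomial (Option (Fin n × Fin n)) ℂ :=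
    fun o => o.elim ((X none : MvPolynomial (Option (Fin n × Fin n)) ℂ) - 1) (fun p => X (some p))
    with hg
  have heval : aeval g (∑ σ : Equiv.Perm (Fin n),
        (MvPolynomial.X none : MvPolynomial (Option (Fin n × Fin n)) ℂ) ^
            (Finset.univ.filter (fun p : Fin n × Fin n => p.1 < p.2 ∧ σ p.2 < σ p.1)).card *
          ∏ i : Fin n, MvPolynomial.X (some (σ i, i))) = ∑ σ : Equiv.Perm (Fin n),
      ((MvPolynomial.X none : MvPolynomial (Option (Fin n × Fin n)) ℂ) - 1) ^
          (Finset.univ.filter (fun p : Fin n × Fin n => p.1 < p.2 ∧ σ p.2 < σ p.1)).card *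
        ∏ i : Fin n, MvPolynomial.X (some (σ i, i)) := by
    simp only [hg, map_sum, map_mul, map_pow, map_prod, aeval_X, Option.elim_none, Option.elim_some]
  rw [← heval]
  refine (complexity_aeval_le _ _).trans (Nat.add_le_add_left ?_ _)
  rw [Fintype.sum_option]
  have h0 : ∑ p : Fin n × Fin n, complexity (g (some p)) = 0 :=
    Finset.sum_eq_zero fun p _ => by simp only [hg, Option.elim_some]; exact complexity_X_holds _
  have h1 : complexity (g none) ≤ 1 := by
    have h := complexity_add_le_holds (X none : MvPolynomial (Option (Fin n × Fin n)) ℂ) (C (-1))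
    rw [complexity_X_holds, complexity_C_holds] at h
    have e : (X none : MvPolynomial (Option (Fin n × Fin n)) ℂ) + C (-1) = X none - 1 := by
      rw [map_neg, map_one, ← sub_eq_add_neg]
    rw [e] at h
    simpa only [hg, Option.elim_none, zero_add] using h
  omega

/-- **Growth bookkeeping**: `(n(n-1)/2 + 1)(n^a + a + 3) + 1 ≤ n^(a+5)` for `n ≥ a + 3`.
[folklore] -/
theorem growth_bound (a n : ℕ) (hn : a + 3 ≤ n) :
    (n * (n - 1) / 2 + 1) * (n ^ a + a + 3) + 1 ≤ n ^ (a + 5) := by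
  have hn1 : 1 ≤ n := by omega
  have hn2 : 2 ≤ n := by omega
  have hd1 : n * (n - 1) / 2 + 1 ≤ n * n := by
    have h1 : n * (n - 1) / 2 ≤ n * (n - 1) := Nat.div_le_self _ _
    have h2 : n * (n - 1) = n * n - n := Nat.mul_sub_one n n
    have h3 : n ≤ n * n := Nat.le_mul_self n
    omega
  have hA : n ^ a + a + 3 ≤ n ^ (a + 2) := by
    have h1 : n ≤ n ^ (a + 1) := by
      calc n = n ^ 1 := (pow_one n).symm
        _ ≤ n ^ (a + 1) := Nat.pow_le_pow_right hn1 (by omega)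
    have h2 : n ^ a ≤ n ^ (a + 1) := Nat.pow_le_pow_right hn1 (by omega)
    have h3 : 2 * n ^ (a + 1) ≤ n ^ (a + 2) := by
      calc 2 * n ^ (a + 1) ≤ n * n ^ (a + 1) := Nat.mul_le_mul_right _ hn2
        _ = n ^ (a + 2) := by ring
    omega
  have h4 : 1 ≤ n ^ (a + 4) := Nat.one_le_pow _ _ hn1
  calc (n * (n - 1) / 2 + 1) * (n ^ a + a + 3) + 1 ≤ n * n * n ^ (a + 2) + 1 :=
        Nat.add_le_add_right (Nat.mul_le_mul hd1 hA) 1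
    _ = n ^ (a + 4) + 1 := by ring
    _ ≤ n ^ (a + 4) + n ^ (a + 4) := Nat.add_le_add_left h4 _
    _ = 2 * n ^ (a + 4) := by ring
    _ ≤ n * n ^ (a + 4) := Nat.mul_le_mul_right _ hn2
    _ = n ^ (a + 5) := by ring

end UniformJet

open MvPolynomial Literature.Computability.AlgebraicComplexity
open Summit.ValiantsHypothesis.ValiantsHypothesis.Theorems.FermionicJetPencilControlsHC

/-- **Settles `stmt-ValiantsHypothesis-16739` (crux `UniformJetUpperBound`, route AnyonJets).**
`VP_ℂ = VNP_ℂ ⟹ ∃ c n₀, ∀ n ≥ n₀, ∀ k, L_ℂ(J_{n,k}) ≤ n^c` for the inversion jets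
`J_{n,k} = ∑_σ sgn σ · binom(inv σ, k) ∏ᵢ X_{σ i, i}`: the composition of the registered line `birth`
over the landed stubs `stub_pencilVNP` (the inversion pencil is in `VNP`, hence in `VP`,
`L(P_n) ≤ n^a + a`), `stub_jetTaylor` (`J_{n,k} ⊗ ℂ = (-1)^k [u^k] P_n(u-1; X)`, `u`-degree
`≤ n(n-1)/2`), the one-gate shift `complexity_shift_le` and the interpolation bound
`complexity_coeff_optionEquivLeft_le`, giving `c = a + 5`, `n₀ = a + 3` (`growth_bound`).
HONEST FRAMING: conditional on `VP = VNP`; `VP ≠ VNP` is NOT proved.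
[cite: Valiant1979, §4] [cite: Burgisser2000, §2.1, Rem. 2.2, Prop. 2.20] -/
theorem uniformJetUpperBound_proof :
    Summit.ValiantsHypothesis.ValiantsHypothesis.Theses.AnyonJets.UniformJetUpperBound := by
  dsimp only [Summit.ValiantsHypothesis.ValiantsHypothesis.Theses.AnyonJets.UniformJetUpperBound]
  intro hEq
  -- the pencil is a VP family
  have hfam := stub_pencilVNP
  have hmem := (mem_VNP_ofFintype_iff_holds (k := ℂ) (σ := fun n => Option (Fin n × Fin n)) _).2 hfam
  rw [← hEq] at hmem
  have hVP := (mem_VP_ofFintype_iff_holds (k := ℂ) (σ := fun n => Option (Fin n × Fin n)) _).1 hmem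
  obtain ⟨a, ha⟩ := hVP.2
  refine ⟨a + 5, a + 3, fun n hn k => ?_⟩
  have hPn : complexity (∑ σ : Equiv.Perm (Fin n),
        (MvPolynomial.X none : MvPolynomial (Option (Fin n × Fin n)) ℂ) ^
            (Finset.univ.filter (fun p : Fin n × Fin n => p.1 < p.2 ∧ σ p.2 < σ p.1)).card *
          ∏ i : Fin n, MvPolynomial.X (some (σ i, i))) ≤ n ^ a + a := ha n
  obtain ⟨hd, hJ⟩ := stub_jetTaylor n
  rw [hJ k]
  refine (complexity_smul_le_holds _ _).trans ?_
  have hcoeff := complexity_coeff_optionEquivLeft_le _ hd k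
  have hF := UniformJet.complexity_shift_le n
  refine (Nat.add_le_add_right hcoeff 1).trans ?_
  refine le_trans ?_ (UniformJet.growth_bound a n hn)
  have h1 := Nat.mul_le_mul_left (n * (n - 1) / 2 + 1)
    (show complexity (∑ σ : Equiv.Perm (Fin n),
        ((MvPolynomial.X none : MvPolynomial (Option (Fin n × Fin n)) ℂ) - 1) ^
            (Finset.univ.filter (fun p : Fin n × Fin n => p.1 < p.2 ∧ σ p.2 < σ p.1)).card *
          ∏ i : Fin n, MvPolynomial.X (some (σ i, i))) + 2 ≤ n ^ a + a + 3 by omega)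
  have h2 : (n * (n - 1) / 2 + 1) * (complexity (∑ σ : Equiv.Perm (Fin n),
        ((MvPolynomial.X none : MvPolynomial (Option (Fin n × Fin n)) ℂ) - 1) ^
            (Finset.univ.filter (fun p : Fin n × Fin n => p.1 < p.2 ∧ σ p.2 < σ p.1)).card *
          ∏ i : Fin n, MvPolynomial.X (some (σ i, i))) + 1) + (n * (n - 1) / 2 + 1) + 1 =
      (n * (n - 1) / 2 + 1) * (complexity (∑ σ : Equiv.Perm (Fin n),
        ((MvPolynomial.X none : MvPolynomial (Option (Fin n × Fin n)) ℂ) - 1) ^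
            (Finset.univ.filter (fun p : Fin n × Fin n => p.1 < p.2 ∧ σ p.2 < σ p.1)).card *
          ∏ i : Fin n, MvPolynomial.X (some (σ i, i))) + 2) + 1 := by ring
  omega

end Summit.ValiantsHypothesis.ValiantsHypothesis.Theorems.AnyonJets

end
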